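import Summits.CriticalPhenomena.PercolationContinuityZ3.Theorems.Transplant.Slab111HubBuild
import Summits.CriticalPhenomena.PercolationContinuityZ3.Theorems.Transplant.Slab111HubXRoute2
import HarnessLib

/-!
# The HUB ROUTING of the `(111)`-films, XIII-X: ZONE-FREE hub plans (`HubPlanX`: exact ride windows, hub levels anywhere in `[1, k−1]`)

builds on p205010 (kernel theorem, internal audit signed; external expert review pending) — NOT used in this file.  Lane `prim-bschramm`, seat
`prim-bschramm-p2` (gen 37; class C1b; memo `HOME/bschramm/P2-LATTICES.md` §135); helper file (`--supports stmt-CriticalPhenomena-4575 --as helper`).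
«Slab111HubPlan2».`HubPlan2` for the small-`k` (zone-free) dispatcher of gen 37: the SAME data (faces, attachment directions, relative legs,
terminal columns and levels, hub levels `LA`, `LD = LA + 3τ`) with (i) the hub levels anywhere in `[1, k−1]` (no zone margins), (ii) the separation
conditions `sIJ` against the EXACT ride windows of «Slab111HubXData».`HubDataX` (`F₁`: between `ℓ₁` and `LD + d₁`; `F₂`, `F₃`: between the attachment
levels `LA + dᵢ`, `LD + dᵢ` and `ℓᵢ`), and (iii) explicit membership of the five attachment vertices (`hatD1`, `hatA2`, `hatD2`, `hatA3`, `hatD3`), which may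
lie on a boundary level.  **`HubPlanX.toHubDataX`** and the swap pair **`HubPlanX.swap`** are in «Slab111HubXBuild».
[cite: DuminilCopinSidoraviciusTassion2016, §2.3 (proof of Fact 2: the three disjoint paths γ_u, γ_v, γ_w in B_R(z))]
-/

noncomputable section

namespace Summit.CriticalPhenomena.PercolationContinuityZ3.Theorems.Transplant

open Literature.Probability.Percolation Literature.Probability.LatticeModels SimpleGraph
open scoped Classical

namespace Slab111

variable {k : ℕ}

/-- **A ZONE-FREE HUB PLAN** (exact ride windows, hub levels in `[1, k−1]`, attachment memberships explicit): a table entry of the dispatcher (faces `F1 F2 F3` with attachment directions, relative legs `l₁ l₂ l₃`) instantiated at a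
configuration (terminal columns `qᵢ` relative to the hub `h`, levels `nᵢ`) with a hub zone (`LA`, `LD = LA + 3τ`), together with the side conditions in
dischargeable form: bulk membership of the region columns, level ranges of the legs, column-or-level separation of every leg vertex from the other
faces' ride windows, from the hubs and from the other legs. [cite: DuminilCopinSidoraviciusTassion2016, §2.3 (proof of Fact 2: γ_u, γ_v, γ_w)] -/
structure HubPlanX (k : ℕ) (h : Site 2) (c0 : ℤ) (W PR : Set (slab111 k)) (E₁ E₂ w' : slab111 k) where
  /-- region columns (relative to the hub): bulk vertices over `Pc` lie in `PR`, over `Wc` in `W` -/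
  (Pc Wc : List (ℤ × ℤ))
  /-- terminal columns and levels -/
  (q₁ q₂ q₃ : ℤ × ℤ) (n₁ n₂ n₃ : ℤ)
  /-- faces and attachment directions -/
  (F1 F2 F3 : FaceD) (d₁ d₂ d₃ : ℤ)
  /-- relative legs -/
  (l₁ l₂ l₃ : List MV)
  /-- hub zone -/
  (LA LD τ : ℤ)
  hz : (3 : ℤ) ∣ h 0 + 2 * h 1 - c0
  hPRW : PR ⊆ W
  hPc : ∀ q ∈ Pc, ∀ L : ℤ, 1 ≤ L → L ≤ (k : ℤ) - 1 → (3 : ℤ) ∣ L - c0 - (q.1 + 2 * q.2) → vl k (vcol h q) L ∈ PR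
  hWc : ∀ q ∈ Wc, ∀ L : ℤ, 1 ≤ L → L ≤ (k : ℤ) - 1 → (3 : ℤ) ∣ L - c0 - (q.1 + 2 * q.2) → vl k (vcol h q) L ∈ W
  hE1 : sh E₁ = vcol h q₁ ∧ lev (E₁ : Site 3) = n₁
  hE2 : sh E₂ = vcol h q₂ ∧ lev (E₂ : Site 3) = n₂
  hE3 : sh w' = vcol h q₃ ∧ lev (w' : Site 3) = n₃
  hE1P : E₁ ∈ PR
  hE2P : E₂ ∈ PR
  hE3W : w' ∈ W
  hne : E₁ ≠ E₂
  hF1 : F1.ok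
  hF2 : F2.ok
  hF3 : F3.ok
  ho1 : F1.OffHub
  ho2 : F2.OffHub
  ho3 : F3.OffHub
  h12 : F1.Disj F2
  h13 : F1.Disj F3
  h23 : F2.Disj F3
  hA1 : Att F1 d₁
  hA2 : Att F2 d₂
  hA3 : Att F3 d₃
  hF1P : F1.f0 ∈ Pc ∧ F1.f1 ∈ Pc ∧ F1.f2 ∈ Pc
  hF2P : F2.f0 ∈ Pc ∧ F2.f1 ∈ Pc ∧ F2.f2 ∈ Pc
  hF3W : F3.f0 ∈ Wc ∧ F3.f1 ∈ Wc ∧ F3.f2 ∈ Wc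
  /-- the hub column is a rerouting-region column -/
  hub_mem : ((0 : ℤ), (0 : ℤ)) ∈ Pc
  hl1 : LegOK l₁
  hl2 : LegOK l₂
  hl3 : LegOK l₃
  /-- the legs end on their faces -/
  he1 : F1.mem (q₁ + (l₁.getLast hl1.1).1)
  he2 : F2.mem (q₂ + (l₂.getLast hl2.1).1)
  he3 : F3.mem (q₃ + (l₃.getLast hl3.1).1)
  /-- the other leg vertices are off their own face; the non-terminal ones are film vertices lying in `PR` (resp. `W`) -/
  ho1' : ∀ p ∈ l₁, p ≠ l₁.getLast hl1.1 → ¬ F1.mem (q₁ + p.1)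
  ho2' : ∀ p ∈ l₂, p ≠ l₂.getLast hl2.1 → ¬ F2.mem (q₂ + p.1)
  ho3' : ∀ p ∈ l₃, p ≠ l₃.getLast hl3.1 → ¬ F3.mem (q₃ + p.1)
  hc1 : ∀ p ∈ l₁, p ≠ ((0, 0), 0) → (0 ≤ n₁ + p.2 ∧ n₁ + p.2 ≤ k) ∧ absV k (vcol h q₁) n₁ p ∈ PR
  hc2 : ∀ p ∈ l₂, p ≠ ((0, 0), 0) → (0 ≤ n₂ + p.2 ∧ n₂ + p.2 ≤ k) ∧ absV k (vcol h q₂) n₂ p ∈ PR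
  hc3 : ∀ p ∈ l₃, p ≠ ((0, 0), 0) → (0 ≤ n₃ + p.2 ∧ n₃ + p.2 ≤ k) ∧ absV k (vcol h q₃) n₃ p ∈ W
  hn1 : 0 ≤ n₁ ∧ n₁ ≤ k
  hn2 : 0 ≤ n₂ ∧ n₂ ≤ k
  hn3 : 0 ≤ n₃ ∧ n₃ ≤ k
  /-- the zone -/
  hτ : τ = 1 ∨ τ = -1
  hLD : LD = LA + 3 * τ
  hLA : (3 : ℤ) ∣ LA - c0
  hLA1 : 1 ≤ LA
  hLAk : LA ≤ (k : ℤ) - 1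
  hLD1 : 1 ≤ LD
  hLDk : LD ≤ (k : ℤ) - 1
  /-- the attachment vertices (possibly on a boundary level) lie in the regions -/
  hatD1 : rideV k h c0 F1 (LD + d₁) ∈ PR
  hatA2 : rideV k h c0 F2 (LA + d₂) ∈ PR
  hatD2 : rideV k h c0 F2 (LD + d₂) ∈ PR
  hatA3 : rideV k h c0 F3 (LA + d₃) ∈ W
  hatD3 : rideV k h c0 F3 (LD + d₃) ∈ W
  /-- `e₁` is before `c = att(F1, H_A)` in the direction `τ` -/
  hside : 0 ≤ τ * (LA + d₁ - (n₁ + (l₁.getLast hl1.1).2))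
  /-- separation of the legs from the OTHER faces: off their columns, or outside their window -/
  s21 : ∀ p ∈ l₁, p ≠ l₁.getLast hl1.1 → ¬ F2.mem (q₁ + p.1) ∨ n₁ + p.2 < min (n₂ + (l₂.getLast hl2.1).2) (min LA LD + d₂) ∨
    max (n₂ + (l₂.getLast hl2.1).2) (max LA LD + d₂) < n₁ + p.2
  s31 : ∀ p ∈ l₁, p ≠ l₁.getLast hl1.1 → ¬ F3.mem (q₁ + p.1) ∨ n₁ + p.2 < min (n₃ + (l₃.getLast hl3.1).2) (min LA LD + d₃) ∨
    max (n₃ + (l₃.getLast hl3.1).2) (max LA LD + d₃) < n₁ + p.2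
  s12 : ∀ p ∈ l₂, p ≠ l₂.getLast hl2.1 → ¬ F1.mem (q₂ + p.1) ∨ n₂ + p.2 < min (n₁ + (l₁.getLast hl1.1).2) (LD + d₁) ∨
    max (n₁ + (l₁.getLast hl1.1).2) (LD + d₁) < n₂ + p.2
  s32 : ∀ p ∈ l₂, p ≠ l₂.getLast hl2.1 → ¬ F3.mem (q₂ + p.1) ∨ n₂ + p.2 < min (n₃ + (l₃.getLast hl3.1).2) (min LA LD + d₃) ∨
    max (n₃ + (l₃.getLast hl3.1).2) (max LA LD + d₃) < n₂ + p.2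
  s13 : ∀ p ∈ l₃, p ≠ l₃.getLast hl3.1 → ¬ F1.mem (q₃ + p.1) ∨ n₃ + p.2 < min (n₁ + (l₁.getLast hl1.1).2) (LD + d₁) ∨
    max (n₁ + (l₁.getLast hl1.1).2) (LD + d₁) < n₃ + p.2
  s23 : ∀ p ∈ l₃, p ≠ l₃.getLast hl3.1 → ¬ F2.mem (q₃ + p.1) ∨ n₃ + p.2 < min (n₂ + (l₂.getLast hl2.1).2) (min LA LD + d₂) ∨
    max (n₂ + (l₂.getLast hl2.1).2) (max LA LD + d₂) < n₃ + p.2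
  /-- leg vertices are not the hubs -/
  hh1 : ∀ p ∈ l₁, p ≠ l₁.getLast hl1.1 → q₁ + p.1 ≠ (0, 0) ∨ (n₁ + p.2 ≠ LA ∧ n₁ + p.2 ≠ LD)
  hh2 : ∀ p ∈ l₂, p ≠ l₂.getLast hl2.1 → q₂ + p.1 ≠ (0, 0) ∨ (n₂ + p.2 ≠ LA ∧ n₂ + p.2 ≠ LD)
  hh3 : ∀ p ∈ l₃, p ≠ l₃.getLast hl3.1 → q₃ + p.1 ≠ (0, 0) ∨ (n₃ + p.2 ≠ LA ∧ n₃ + p.2 ≠ LD)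
  /-- leg vertices are pairwise distinct across legs -/
  d12 : ∀ p ∈ l₁, p ≠ l₁.getLast hl1.1 → ∀ p' ∈ l₂, p' ≠ l₂.getLast hl2.1 → (q₁ + p.1, n₁ + p.2) ≠ (q₂ + p'.1, n₂ + p'.2)
  d13 : ∀ p ∈ l₁, p ≠ l₁.getLast hl1.1 → ∀ p' ∈ l₃, p' ≠ l₃.getLast hl3.1 → (q₁ + p.1, n₁ + p.2) ≠ (q₃ + p'.1, n₃ + p'.2)
  d23 : ∀ p ∈ l₂, p ≠ l₂.getLast hl2.1 → ∀ p' ∈ l₃, p' ≠ l₃.getLast hl3.1 → (q₂ + p.1, n₂ + p.2) ≠ (q₃ + p'.1, n₃ + p'.2)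

namespace HubPlanX

variable {h : Site 2} {c0 : ℤ} {W PR : Set (slab111 k)} {E₁ E₂ w' : slab111 k} (Q : HubPlanX k h c0 W PR E₁ E₂ w')

/-- The level of `e₁`. [folklore] -/
def ℓ₁ : ℤ := Q.n₁ + (Q.l₁.getLast Q.hl1.1).2
/-- The level of `e₂`. [folklore] -/
def ℓ₂ : ℤ := Q.n₂ + (Q.l₂.getLast Q.hl2.1).2
/-- The level of `e₃`. [folklore] -/
def ℓ₃ : ℤ := Q.n₃ + (Q.l₃.getLast Q.hl3.1).2

/-- Class consistency of the three terminals. [folklore] -/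
theorem hq : ((3 : ℤ) ∣ Q.n₁ - c0 - (Q.q₁.1 + 2 * Q.q₁.2)) ∧ ((3 : ℤ) ∣ Q.n₂ - c0 - (Q.q₂.1 + 2 * Q.q₂.2)) ∧
    ((3 : ℤ) ∣ Q.n₃ - c0 - (Q.q₃.1 + 2 * Q.q₃.2)) := by
  refine ⟨?_, ?_, ?_⟩
  · have ha := (exists_eq_vl E₁).1
    obtain ⟨hd, -, -⟩ := ha
    rw [Q.hE1.1, Q.hE1.2] at hd
    have e : Q.n₁ - c0 - (Q.q₁.1 + 2 * Q.q₁.2) = (Q.n₁ - lvl (vcol h Q.q₁)) + (h 0 + 2 * h 1 - c0) := by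
      simp only [lvl, vcol_apply_zero, vcol_apply_one]; ring
    rw [e]; exact dvd_add hd Q.hz
  · have ha := (exists_eq_vl E₂).1
    obtain ⟨hd, -, -⟩ := ha
    rw [Q.hE2.1, Q.hE2.2] at hd
    have e : Q.n₂ - c0 - (Q.q₂.1 + 2 * Q.q₂.2) = (Q.n₂ - lvl (vcol h Q.q₂)) + (h 0 + 2 * h 1 - c0) := by
      simp only [lvl, vcol_apply_zero, vcol_apply_one]; ring
    rw [e]; exact dvd_add hd Q.hz
  · have ha := (exists_eq_vl w').1
    obtain ⟨hd, -, -⟩ := ha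
    rw [Q.hE3.1, Q.hE3.2] at hd
    have e : Q.n₃ - c0 - (Q.q₃.1 + 2 * Q.q₃.2) = (Q.n₃ - lvl (vcol h Q.q₃)) + (h 0 + 2 * h 1 - c0) := by
      simp only [lvl, vcol_apply_zero, vcol_apply_one]; ring
    rw [e]; exact dvd_add hd Q.hz

/-- Level range of every leg vertex. [folklore] -/
theorem rng : (∀ p ∈ Q.l₁, 0 ≤ Q.n₁ + p.2 ∧ Q.n₁ + p.2 ≤ k) ∧ (∀ p ∈ Q.l₂, 0 ≤ Q.n₂ + p.2 ∧ Q.n₂ + p.2 ≤ k) ∧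
    (∀ p ∈ Q.l₃, 0 ≤ Q.n₃ + p.2 ∧ Q.n₃ + p.2 ≤ k) := by
  refine ⟨?_, ?_, ?_⟩
  · intro p hp
    by_cases h0 : p = ((0, 0), 0)
    · subst h0; simpa using Q.hn1
    · exact (Q.hc1 p hp h0).1
  · intro p hp
    by_cases h0 : p = ((0, 0), 0)
    · subst h0; simpa using Q.hn2
    · exact (Q.hc2 p hp h0).1
  · intro p hp
    by_cases h0 : p = ((0, 0), 0)
    · subst h0; simpa using Q.hn3
    · exact (Q.hc3 p hp h0).1

/-- The terminals as `vl`. [folklore] -/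
theorem E_eq : E₁ = vl k (vcol h Q.q₁) Q.n₁ ∧ E₂ = vl k (vcol h Q.q₂) Q.n₂ ∧ w' = vl k (vcol h Q.q₃) Q.n₃ := by
  refine ⟨?_, ?_, ?_⟩
  · have := (exists_eq_vl E₁).2; rw [Q.hE1.1, Q.hE1.2] at this; exact this
  · have := (exists_eq_vl E₂).2; rw [Q.hE2.1, Q.hE2.2] at this; exact this
  · have := (exists_eq_vl w').2; rw [Q.hE3.1, Q.hE3.2] at this; exact this

/-- The last leg vertices are the ride vertices `eᵢ = rideV Fᵢ ℓᵢ`. [folklore] -/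
theorem last_eq : absV k (vcol h Q.q₁) Q.n₁ (Q.l₁.getLast Q.hl1.1) = rideV k h c0 Q.F1 Q.ℓ₁ ∧
    absV k (vcol h Q.q₂) Q.n₂ (Q.l₂.getLast Q.hl2.1) = rideV k h c0 Q.F2 Q.ℓ₂ ∧
    absV k (vcol h Q.q₃) Q.n₃ (Q.l₃.getLast Q.hl3.1) = rideV k h c0 Q.F3 Q.ℓ₃ := by
  refine ⟨?_, ?_, ?_⟩
  · set p := Q.l₁.getLast Q.hl1.1
    have hp : p ∈ Q.l₁ := List.getLast_mem _
    obtain ⟨hs, hl⟩ := sh_lev_legV (k := k) Q.hz Q.hq.1 (Q.hl1.2.2.2.2 p hp) (Q.rng.1 p hp).1 (Q.rng.1 p hp).2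
    refine rideV_eq_of_sh_lev Q.hz Q.hF1 (by have := (Q.rng.1 p hp).1; unfold ℓ₁; omega) (by have := (Q.rng.1 p hp).2; unfold ℓ₁; omega) ?_ hl
    rw [hs, colAt_eq_of_faceMem Q.hF1 Q.he1]
    have h1 := Q.hq.1; have h2 := Q.hl1.2.2.2.2 p hp
    unfold RAdm at h2; unfold ℓ₁
    have e : (Q.q₁ + p.1).1 + 2 * (Q.q₁ + p.1).2 - (Q.n₁ + p.2 - c0) =
        -(Q.n₁ - c0 - (Q.q₁.1 + 2 * Q.q₁.2)) - (p.2 - (p.1.1 + 2 * p.1.2)) := by simp only [Prod.fst_add, Prod.snd_add]; ring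
    rw [e]; exact dvd_sub (dvd_neg.2 h1) h2
  · set p := Q.l₂.getLast Q.hl2.1
    have hp : p ∈ Q.l₂ := List.getLast_mem _
    obtain ⟨hs, hl⟩ := sh_lev_legV (k := k) Q.hz Q.hq.2.1 (Q.hl2.2.2.2.2 p hp) (Q.rng.2.1 p hp).1 (Q.rng.2.1 p hp).2
    refine rideV_eq_of_sh_lev Q.hz Q.hF2 (by have := (Q.rng.2.1 p hp).1; unfold ℓ₂; omega) (by have := (Q.rng.2.1 p hp).2; unfold ℓ₂; omega) ?_ hl
    rw [hs, colAt_eq_of_faceMem Q.hF2 Q.he2]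
    have h1 := Q.hq.2.1; have h2 := Q.hl2.2.2.2.2 p hp
    unfold RAdm at h2; unfold ℓ₂
    have e : (Q.q₂ + p.1).1 + 2 * (Q.q₂ + p.1).2 - (Q.n₂ + p.2 - c0) =
        -(Q.n₂ - c0 - (Q.q₂.1 + 2 * Q.q₂.2)) - (p.2 - (p.1.1 + 2 * p.1.2)) := by simp only [Prod.fst_add, Prod.snd_add]; ring
    rw [e]; exact dvd_sub (dvd_neg.2 h1) h2
  · set p := Q.l₃.getLast Q.hl3.1
    have hp : p ∈ Q.l₃ := List.getLast_mem _
    obtain ⟨hs, hl⟩ := sh_lev_legV (k := k) Q.hz Q.hq.2.2 (Q.hl3.2.2.2.2 p hp) (Q.rng.2.2 p hp).1 (Q.rng.2.2 p hp).2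
    refine rideV_eq_of_sh_lev Q.hz Q.hF3 (by have := (Q.rng.2.2 p hp).1; unfold ℓ₃; omega) (by have := (Q.rng.2.2 p hp).2; unfold ℓ₃; omega) ?_ hl
    rw [hs, colAt_eq_of_faceMem Q.hF3 Q.he3]
    have h1 := Q.hq.2.2; have h2 := Q.hl3.2.2.2.2 p hp
    unfold RAdm at h2; unfold ℓ₃
    have e : (Q.q₃ + p.1).1 + 2 * (Q.q₃ + p.1).2 - (Q.n₃ + p.2 - c0) =
        -(Q.n₃ - c0 - (Q.q₃.1 + 2 * Q.q₃.2)) - (p.2 - (p.1.1 + 2 * p.1.2)) := by simp only [Prod.fst_add, Prod.snd_add]; ring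
    rw [e]; exact dvd_sub (dvd_neg.2 h1) h2

/-- The last leg vertex of `l₁` lies in `PR` (terminal or member). [folklore] -/
theorem last_mem1 : absV k (vcol h Q.q₁) Q.n₁ (Q.l₁.getLast Q.hl1.1) ∈ PR := by
  by_cases hlast : Q.l₁.getLast Q.hl1.1 = ((0, 0), 0)
  · rw [hlast, absV_zero, ← Q.E_eq.1]; exact Q.hE1P
  · exact (Q.hc1 _ (List.getLast_mem _) hlast).2

/-- The last leg vertex of `l₂` lies in `PR`. [folklore] -/
theorem last_mem2 : absV k (vcol h Q.q₂) Q.n₂ (Q.l₂.getLast Q.hl2.1) ∈ PR := by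
  by_cases hlast : Q.l₂.getLast Q.hl2.1 = ((0, 0), 0)
  · rw [hlast, absV_zero, ← Q.E_eq.2.1]; exact Q.hE2P
  · exact (Q.hc2 _ (List.getLast_mem _) hlast).2

/-- The last leg vertex of `l₃` lies in `W`. [folklore] -/
theorem last_mem3 : absV k (vcol h Q.q₃) Q.n₃ (Q.l₃.getLast Q.hl3.1) ∈ W := by
  by_cases hlast : Q.l₃.getLast Q.hl3.1 = ((0, 0), 0)
  · rw [hlast, absV_zero, ← Q.E_eq.2.2]; exact Q.hE3W
  · exact (Q.hc3 _ (List.getLast_mem _) hlast).2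

end HubPlanX

end Slab111

end Summit.CriticalPhenomena.PercolationContinuityZ3.Theorems.Transplant

end
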